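import Summits.SmoothPoincare4.SmoothPoincare4.Theorems.ConvexBisectionAcyclicBisectionExistsStabBaseCutPower
import Literature.Topology.FourManifolds.LefschetzBaseCover
import HarnessLib

/-!
# N3 (`stub_STgeo`) ▸ N3-nat ▸ N3d-1 `node_stabBaseData` ▸ G1a/G1b: THE FIBRED GENUS-RAISING EMBEDDING
# `stabEmb g : ℂ² → ℂ²`, `stabMap g : Base g ∖ (cut) → Base (g+1)` — the bulk of the 1-handle presentation `E.jA`
(wave 8, brick J6-2b of stub `stub_STgeo` = node N3 of NF4, line `modp-braid-orbits`, crux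
`ConvexBisection.AcyclicBisectionExists`, item stmt-SmoothPoincare4-10508; registered sub-goal
`helper_rho_stabEmb`; sequel of `…StabBaseCutPower.lean` (the compressed power `stabX`); what remains of
N3d-1 = `H6Remaining.RemainingN3d1`, report H6 §5.)

With `X = stabX g x` (`X^{2g+3} = λ x^{2g+1}`, `λ = e^{radProfile ‖x‖²} ≥ 1`, `= 1` for `‖x‖² ≤ 3`) the second
coordinate is `Y = y · √(1 + (λ − 1) x^{2g+1}/y²)`, so that `Y² − X^{2g+3} = y² − x^{2g+1}` EXACTLY:

* §4 `stabR = 1 + (λ − 1) x^{2g+1} / y²` (`= 1` for `‖x‖² ≤ 3`, where all roots `y = 0` of the pages are;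
  positive real part when `‖w‖ ≤ 1/2`: `‖x^{2g+1}‖ ≥ √3 > 3/2 ≥ ‖1 + w‖`), `hsqrt z = exp (log z / 2)`,
  `stabY = y · hsqrt stabR`, **`stabEmb g (x, y) = (stabX g x, stabY g x y)`**: `Φ_{g+1} ∘ stabEmb = Φ_g`,
  **`w_{g+1} ∘ stabEmb = w_g`**, **`rho_{g+1} ∘ stabEmb = rho_g`** (for `x ≠ 0`, `‖w‖ ≤ 1/2`; registered
  `helper_rho_stabEmb`), injective on `{−x ∈ slitPlane, ‖w‖ ≤ 1/2}`;
* §5 on the base: the open submanifold `cutDomain g = {−x ∈ slitPlane} ⊆ Base g` and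
  **`stabMap g : cutDomain g → Base (g+1)`** — `w`-preserving (FIBRED), `rho`-preserving (boundary to
  boundary, interior to interior), page to page of the SAME direction, `‖x‖`-non-increasing on `‖x‖ ≥ 1` and
  `‖x‖`-preserving on `‖x‖² ≥ 4`, injective.

Smoothness, the page-orientation character and the images of the chain loops are the sequel's.  Definitions +
proved lemmas; no named facts, no `sorry`.  References: J. Milnor, *Singular points of complex
hypersurfaces* (1968), §9 [Milnor1968]; J. B. Etnyre, T. Fuller, IMRN 2006, §2 [EtnyreFuller2006].
-/

noncomputable section

-- the prescribed namespace `Summit.<P>.<Sub>.…` duplicates `SmoothPoincare4` (P = Sub)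
set_option linter.dupNamespace false

open scoped Topology Real
open Set Function Metric
open Literature.Topology.FourManifolds Literature.Topology.FourManifolds.LefschetzBase

namespace Summit.SmoothPoincare4.SmoothPoincare4.Theorems.AcyclicBisectionExists.ModpBraidOrbits

namespace StabBase

variable {g : ℕ}

/-! ## §4 The correction factor, the half-power and the map `stabEmb` -/

/-- The factor `λ = e^{radProfile ‖x‖²} ≥ 1` (`= 1` for `‖x‖² ≤ 3`, `= ‖x‖²` for `‖x‖² ≥ 4`). [folklore] -/
def lam (x : ℂ) : ℝ := Real.exp (radProfile (‖x‖ ^ 2))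

/-- `1 ≤ λ`. [folklore] -/
theorem one_le_lam (x : ℂ) : 1 ≤ lam x := by
  unfold lam
  exact Real.one_le_exp (radProfile_nonneg' _)

/-- `λ = 1` for `‖x‖² ≤ 3`. [folklore] -/
theorem lam_of_le_three {x : ℂ} (h : ‖x‖ ^ 2 ≤ 3) : lam x = 1 := by
  rw [lam, radProfile_of_le_three h, Real.exp_zero]

/-- **The correction ratio** `stabR = 1 + (λ − 1) x^{2g+1} / y²` (`= Y²/y²`). [folklore] -/
def stabR (g : ℕ) (x y : ℂ) : ℂ := 1 + ((lam x - 1 : ℝ) : ℂ) * x ^ (2 * g + 1) / y ^ 2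

/-- `stabR = 1` for `‖x‖² ≤ 3` (where all the roots `y = 0` are). [folklore] -/
theorem stabR_of_le_three {x : ℂ} (y : ℂ) (h : ‖x‖ ^ 2 ≤ 3) : stabR g x y = 1 := by
  simp [stabR, lam_of_le_three h]

/-- **The half-power** `hsqrt z = exp (log z / 2)`, a square root of `z ≠ 0`, never zero, analytic off
`(−∞, 0]`. [folklore] -/
def hsqrt (z : ℂ) : ℂ := Complex.exp (Complex.log z / 2)

/-- `hsqrt z ≠ 0`. [folklore] -/
theorem hsqrt_ne_zero (z : ℂ) : hsqrt z ≠ 0 := Complex.exp_ne_zero _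

/-- `hsqrt z ^ 2 = z` for `z ≠ 0`. [folklore] -/
theorem hsqrt_sq {z : ℂ} (hz : z ≠ 0) : hsqrt z ^ 2 = z := by
  rw [hsqrt, ← Complex.exp_nat_mul]
  push_cast
  rw [mul_div_cancel₀ _ two_ne_zero, Complex.exp_log hz]

/-- The second coordinate `stabY = y · hsqrt stabR`. [folklore] -/
def stabY (g : ℕ) (x y : ℂ) : ℂ := y * hsqrt (stabR g x y)

/-- **The fibred genus-raising map** `stabEmb g (x, y) = (stabX g x, stabY g x y)` of `ℂ² = ℝ⁴`.
[cite: Milnor1968, §9] -/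
def stabEmb (g : ℕ) (p : EuclideanSpace ℝ (Fin 4)) : EuclideanSpace ℝ (Fin 4) :=
  mk (stabX g (cx p)) (stabY g (cx p) (cy p))

/-- First coordinate of `stabEmb`. [folklore] -/
@[simp] theorem cx_stabEmb (p : EuclideanSpace ℝ (Fin 4)) : cx (stabEmb g p) = stabX g (cx p) := by
  simp [stabEmb]

/-- Second coordinate of `stabEmb`. [folklore] -/
@[simp] theorem cy_stabEmb (p : EuclideanSpace ℝ (Fin 4)) : cy (stabEmb g p) = stabY g (cx p) (cy p) := by
  simp [stabEmb]

/-- `y² = x^{2g+1} + (1 + w)`. [folklore] -/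
theorem cy_sq_eq (p : EuclideanSpace ℝ (Fin 4)) : cy p ^ 2 = cx p ^ (2 * g + 1) + (1 + w g p) := by
  simp only [w, Phi]; ring

/-- **The key estimate off `‖x‖² ≤ 3`**: if `‖w‖ ≤ 1/2` and `‖x‖² ≥ 3` then `y ≠ 0` and `Re stabR > 0`
(`‖x^{2g+1}‖ ≥ √3 > 3/2 ≥ ‖1 + w‖`). [folklore] -/
theorem cy_ne_zero_and_re_stabR_pos {p : EuclideanSpace ℝ (Fin 4)} (hw : ‖w g p‖ ≤ 1 / 2)
    (hx : 3 ≤ ‖cx p‖ ^ 2) : cy p ≠ 0 ∧ 0 < (stabR g (cx p) (cy p)).re := by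
  set a : ℂ := cx p ^ (2 * g + 1) with ha
  set c : ℂ := 1 + w g p with hc
  have hx1 : (17 / 10 : ℝ) < ‖cx p‖ := by nlinarith [norm_nonneg (cx p)]
  have hna : (17 / 10 : ℝ) < ‖a‖ := by
    rw [ha, norm_pow]
    exact hx1.trans_le (le_self_pow₀ (by linarith) (by omega))
  have hnc : ‖c‖ ≤ 3 / 2 := by
    rw [hc]
    calc ‖1 + w g p‖ ≤ ‖(1 : ℂ)‖ + ‖w g p‖ := norm_add_le _ _
      _ ≤ 3 / 2 := by rw [norm_one]; linarith
  have hy2 : cy p ^ 2 = a + c := cy_sq_eq p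
  have hac : a + c ≠ 0 := by
    intro h0
    have : ‖a‖ = ‖c‖ := by
      have e : a = -c := eq_neg_of_add_eq_zero_left h0
      rw [e, norm_neg]
    linarith
  have hy0 : cy p ≠ 0 := by
    intro h0
    rw [h0] at hy2
    exact hac (by rw [← hy2]; ring)
  refine ⟨hy0, ?_⟩
  rw [stabR, hy2, Complex.add_re, Complex.one_re]
  have key : 0 ≤ (((lam (cx p) - 1 : ℝ) : ℂ) * a / (a + c)).re := by
    rw [mul_div_assoc, Complex.re_ofReal_mul]
    refine mul_nonneg (sub_nonneg.2 (one_le_lam _)) ?_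
    rw [Complex.div_re, ← add_div]
    refine div_nonneg ?_ (Complex.normSq_nonneg _)
    have h1 : -(‖a‖ * ‖c‖) ≤ a.re * c.re + a.im * c.im := by
      have hb := Complex.abs_re_le_norm (a * (starRingEnd ℂ) c)
      rw [norm_mul, Complex.norm_conj] at hb
      have e : (a * (starRingEnd ℂ) c).re = a.re * c.re + a.im * c.im := by
        simp [Complex.mul_re]
      rw [e] at hb
      exact (abs_le.1 hb).1
    have h2 : a.re * a.re + a.im * a.im = ‖a‖ ^ 2 := by
      rw [← Complex.normSq_eq_norm_sq, Complex.normSq_apply]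
    have h3 : a.re * (a + c).re + a.im * (a + c).im =
        (a.re * a.re + a.im * a.im) + (a.re * c.re + a.im * c.im) := by
      rw [Complex.add_re, Complex.add_im]; ring
    rw [h3, h2]
    nlinarith [norm_nonneg a, norm_nonneg c]
  linarith

/-- `stabR ≠ 0` when `‖w‖ ≤ 1/2`. [folklore] -/
theorem stabR_ne_zero {p : EuclideanSpace ℝ (Fin 4)} (hw : ‖w g p‖ ≤ 1 / 2) : stabR g (cx p) (cy p) ≠ 0 := by
  rcases le_or_gt (‖cx p‖ ^ 2) 3 with h | h
  · rw [stabR_of_le_three _ h]; exact one_ne_zero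
  · intro h0
    have := (cy_ne_zero_and_re_stabR_pos hw h.le).2
    rw [h0, Complex.zero_re] at this
    exact lt_irrefl _ this

/-- `stabR ∈ slitPlane` when `‖w‖ ≤ 1/2` (positive real part, or `= 1`). [folklore] -/
theorem stabR_mem_slitPlane {p : EuclideanSpace ℝ (Fin 4)} (hw : ‖w g p‖ ≤ 1 / 2) :
    stabR g (cx p) (cy p) ∈ Complex.slitPlane := by
  rw [Complex.mem_slitPlane_iff]
  rcases le_or_gt (‖cx p‖ ^ 2) 3 with h | h
  · left; rw [stabR_of_le_three _ h, Complex.one_re]; exact one_pos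
  · exact Or.inl (cy_ne_zero_and_re_stabR_pos hw h.le).2

/-- `y² · stabR = y² + (λ − 1) x^{2g+1}` (`‖w‖ ≤ 1/2`). [folklore] -/
theorem cy_sq_mul_stabR {p : EuclideanSpace ℝ (Fin 4)} (hw : ‖w g p‖ ≤ 1 / 2) :
    cy p ^ 2 * stabR g (cx p) (cy p) = cy p ^ 2 + ((lam (cx p) - 1 : ℝ) : ℂ) * cx p ^ (2 * g + 1) := by
  rcases le_or_gt (‖cx p‖ ^ 2) 3 with h | h
  · rw [stabR_of_le_three _ h, lam_of_le_three h]; push_cast; ring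
  · have hy := (cy_ne_zero_and_re_stabR_pos hw h.le).1
    unfold stabR
    field_simp

/-- **`Φ` is preserved**: `Φ_{g+1} (stabEmb p) = Φ_g p` for `x ≠ 0`, `‖w‖ ≤ 1/2`. [cite: Milnor1968, §9] -/
theorem Phi_stabEmb {p : EuclideanSpace ℝ (Fin 4)} (hx : cx p ≠ 0) (hw : ‖w g p‖ ≤ 1 / 2) :
    Phi (g + 1) (stabEmb g p) = Phi g p := by
  have e1 : cy (stabEmb g p) ^ 2 = cy p ^ 2 + ((lam (cx p) - 1 : ℝ) : ℂ) * cx p ^ (2 * g + 1) := by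
    rw [cy_stabEmb, stabY, mul_pow, hsqrt_sq (stabR_ne_zero hw), cy_sq_mul_stabR hw]
  have e2 : cx (stabEmb g p) ^ (2 * (g + 1) + 1) = (lam (cx p) : ℂ) * cx p ^ (2 * g + 1) := by
    rw [cx_stabEmb, show 2 * (g + 1) + 1 = 2 * g + 3 by ring, stabX_pow hx]
    rfl
  unfold Phi
  rw [e1, e2]
  push_cast
  ring

/-- **`w` is preserved (the map is FIBRED)**: `w_{g+1} (stabEmb p) = w_g p`. [cite: Milnor1968, §9] -/
theorem w_stabEmb {p : EuclideanSpace ℝ (Fin 4)} (hx : cx p ≠ 0) (hw : ‖w g p‖ ≤ 1 / 2) :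
    w (g + 1) (stabEmb g p) = w g p := by
  unfold w
  rw [Phi_stabEmb hx hw]

/-- **`rho` is preserved**: `rho_{g+1} (stabEmb p) = rho_g p` (boundary to boundary, interior to interior,
`Base g` into `Base (g+1)`). [folklore] -/
theorem rho_stabEmb {p : EuclideanSpace ℝ (Fin 4)} (hx : cx p ≠ 0) (hw : ‖w g p‖ ≤ 1 / 2) :
    rho (g + 1) (stabEmb g p) = rho g p := by
  unfold rho
  rw [w_stabEmb hx hw, cx_stabEmb, eta_norm_stabX_sq]

/-- **`stabEmb` is injective on `{−x ∈ slitPlane, ‖w‖ ≤ 1/2}`.** [cite: Milnor1968, §9] -/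
theorem stabEmb_injOn :
    InjOn (stabEmb g) {p | -cx p ∈ Complex.slitPlane ∧ ‖w g p‖ ≤ 1 / 2} := by
  rintro p ⟨hp1, hp2⟩ q ⟨hq1, hq2⟩ h
  have hX : stabX g (cx p) = stabX g (cx q) := by
    have := congrArg cx h
    rwa [cx_stabEmb, cx_stabEmb] at this
  have hx : cx p = cx q := stabX_injOn hp1 hq1 hX
  have hp0 : cx p ≠ 0 := ne_zero_of_neg_mem_slitPlane hp1
  have hq0 : cx q ≠ 0 := ne_zero_of_neg_mem_slitPlane hq1
  have hw' : w g p = w g q := by rw [← w_stabEmb hp0 hp2, ← w_stabEmb hq0 hq2, h]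
  have hy2 : cy p ^ 2 = cy q ^ 2 := by rw [cy_sq_eq (g := g), cy_sq_eq (g := g), hx, hw']
  have hR : stabR g (cx p) (cy p) = stabR g (cx q) (cy q) := by unfold stabR; rw [hx, hy2]
  have hY : stabY g (cx p) (cy p) = stabY g (cx q) (cy q) := by
    have := congrArg cy h
    rwa [cy_stabEmb, cy_stabEmb] at this
  have hy : cy p = cy q := by
    unfold stabY at hY
    rw [hR] at hY
    exact mul_right_cancel₀ (hsqrt_ne_zero _) hY
  rw [← mk_cx_cy p, ← mk_cx_cy q, hx, hy]

/-! ## §5 On the base: `stabMap g : cutDomain g → Base (g+1)` -/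

/-- **The cut domain** `{−x ∈ slitPlane}` of the base: the open submanifold of `Base g` off the wall
`arg x = 0` (and off the axis `x = 0`). [folklore] -/
def cutDomain (g : ℕ) : TopologicalSpace.Opens (Base g) :=
  ⟨{p | -cx p.1 ∈ Complex.slitPlane},
    Complex.isOpen_slitPlane.preimage ((contDiff_cx.continuous.comp continuous_subtype_val).neg)⟩

/-- Membership in the cut domain. [folklore] -/
theorem mem_cutDomain {p : Base g} : p ∈ cutDomain g ↔ -cx p.1 ∈ Complex.slitPlane := Iff.rfl

/-- Points of the cut domain have `x ≠ 0`. [folklore] -/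
theorem cx_ne_zero_of_mem (p : cutDomain g) : cx p.1.1 ≠ 0 := ne_zero_of_neg_mem_slitPlane p.2

/-- **The fibred genus-raising map of the base**, `cutDomain g → Base (g+1)`. [cite: Milnor1968, §9] -/
def stabMap (g : ℕ) (p : cutDomain g) : Base (g + 1) :=
  ⟨stabEmb g p.1.1, by
    show rho (g + 1) (stabEmb g p.1.1) ≤ 1 / 4
    rw [rho_stabEmb (cx_ne_zero_of_mem p) (norm_w_le p.1)]
    exact p.1.2⟩

/-- The underlying point of `stabMap`. [folklore] -/
@[simp] theorem stabMap_coe (p : cutDomain g) : (stabMap g p).1 = stabEmb g p.1.1 := rfl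

/-- **`stabMap` is fibred**: `w_{g+1} ∘ stabMap = w_g`. [cite: Milnor1968, §9] -/
theorem w_stabMap (p : cutDomain g) : w (g + 1) (stabMap g p).1 = w g p.1.1 :=
  w_stabEmb (cx_ne_zero_of_mem p) (norm_w_le p.1)

/-- **`stabMap` preserves `rho`** (boundary points to boundary points, interior to interior). [folklore] -/
theorem rho_stabMap (p : cutDomain g) : rho (g + 1) (stabMap g p).1 = rho g p.1.1 :=
  rho_stabEmb (cx_ne_zero_of_mem p) (norm_w_le p.1)

/-- `stabMap` does not increase `‖x‖` on `‖x‖ ≥ 1` … [folklore] -/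
theorem norm_cx_stabMap_le (p : cutDomain g) (h : 1 ≤ ‖cx p.1.1‖) : ‖cx (stabMap g p).1‖ ≤ ‖cx p.1.1‖ := by
  rw [stabMap_coe, cx_stabEmb]; exact norm_stabX_le h

/-- … and preserves it on the binding region `‖x‖² ≥ 4`. [folklore] -/
theorem norm_cx_stabMap_eq (p : cutDomain g) (h : 4 ≤ ‖cx p.1.1‖ ^ 2) : ‖cx (stabMap g p).1‖ = ‖cx p.1.1‖ := by
  rw [stabMap_coe, cx_stabEmb]; exact norm_stabX_of_four_le h

/-- **`stabMap` sends the page of direction `d` into the page of direction `d`.** [cite: EtnyreFuller2006, §2] -/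
theorem stabMap_mem_page {d : ℂ} {p : cutDomain g} (hp : p.1 ∈ page g d) : stabMap g p ∈ page (g + 1) d := by
  refine ⟨?_, ?_⟩
  · have hx : ‖cx p.1.1‖ < 2 := by nlinarith [hp.1, norm_nonneg (cx p.1.1)]
    have h2 := norm_stabX_lt_two (g := g) hx
    rw [stabMap_coe, cx_stabEmb]
    nlinarith [norm_nonneg (stabX g (cx p.1.1))]
  · rw [w_stabMap]; exact hp.2

/-- **`stabMap` is injective.** [cite: Milnor1968, §9] -/
theorem injective_stabMap : Injective (stabMap g) := by
  intro p q h
  have h' : stabEmb g p.1.1 = stabEmb g q.1.1 := congrArg (fun z : Base (g + 1) => z.1) h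
  have e := stabEmb_injOn ⟨p.2, norm_w_le p.1⟩ ⟨q.2, norm_w_le q.1⟩ h'
  exact Subtype.ext (Subtype.ext e)

end StabBase

/-! ## Registered helper -/

/-- **Registered helper `helper_rho_stabEmb` (sub-goal of `stub_STgeo` ▸ N3-nat ▸ N3d-1 ▸ G1a/G1b, wave 8,
lead c5): the genus-raising map `stabEmb g` of `ℂ²` preserves `w` and `rho` across genera (`x ≠ 0`,
`‖w‖ ≤ 1/2`) — the bulk of the fibred 1-handle presentation `E.jA` of `Base (g+1)` over `Base g`.**
[cite: Milnor1968, §9] -/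
theorem helper_rho_stabEmb : ∀ (g : ℕ) (p : EuclideanSpace ℝ (Fin 4)), Literature.Topology.FourManifolds.LefschetzBase.cx p ≠ 0 → ‖Literature.Topology.FourManifolds.LefschetzBase.w g p‖ ≤ 1 / 2 → Literature.Topology.FourManifolds.LefschetzBase.w (g + 1) (Summit.SmoothPoincare4.SmoothPoincare4.Theorems.AcyclicBisectionExists.ModpBraidOrbits.StabBase.stabEmb g p) = Literature.Topology.FourManifolds.LefschetzBase.w g p ∧ Literature.Topology.FourManifolds.LefschetzBase.rho (g + 1) (Summit.SmoothPoincare4.SmoothPoincare4.Theorems.AcyclicBisectionExists.ModpBraidOrbits.StabBase.stabEmb g p) = Literature.Topology.FourManifolds.LefschetzBase.rho g p :=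
  fun _ _ hx hw => ⟨StabBase.w_stabEmb hx hw, StabBase.rho_stabEmb hx hw⟩

end Summit.SmoothPoincare4.SmoothPoincare4.Theorems.AcyclicBisectionExists.ModpBraidOrbits

end
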